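import Summits.HodgeConjecture.CorCM.MultiFieldWeilUnitsMenuImprimitiveGrouped
import Summits.HodgeConjecture.CorCM.MultiFieldWeilUnitShapes
import HarnessLib

/-!
# MULTI-FIELD WEIL ENGINE — THE NET THEOREM OF THE UNITS PROGRAMME: the units menu BY SHAPES (at most two classes per sextic field, three per `𝔄₄`/`𝔖₄`-octic field with
# separation, four per decic field under (H1)–(H2)) TOGETHER WITH one `(1,3)`-class over each octic field of ARBITRARY quartic part — the Hodge conjecture for every product of
# copies of `E` and the structures, given only Markman's fourfold and hyperbolic-sixfold theorems

Cell `pub-hodgecm2` (COR-CM), seat b30 gen 40 (2026-08-26); count-neutral own lane MULTI-FIELD WEIL ENGINE (stem `MultiFieldWeil*`), the SHAPE form of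
`CorCM/MultiFieldWeilUnitsMenuImprimitiveGrouped.lean` (G5) exactly as `CorCM/MultiFieldWeilUnitsMenuShapes.lean` (G3) is the shape form of U7: the linear-independence
hypothesis is DISCHARGED from combinatorial conditions on the types over `τ` (`CorCM/MultiFieldWeilUnitShapes.lean`, `CorCM/MultiFieldWeilUnitGramFour.lean`).  Theorems only; no
definition, no named fact, no `sorry`.  HONEST FRAMING: conditional ONLY on the two displayed Markman binders; `HC_CM` is NOT proved and not asserted.

**`hodgeConjectureFor_biproduct_sigma_imprimitive_of_shapes`.**  `k` imaginary quadratic with `τ`, `E ⊨ (k; {τ})`; `J` finite; CM fields `KJ j ⊇ iK j (k)` of degree `2·nJ j`,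
the octic ones FLAGGED (`tJ j`: a degree-`24` pair, quartic part `𝔄₄`/`𝔖₄`) or UNFLAGGED (any quartic part); structures `B j t ⊨ (KJ j; Ψ j t)`, `t : Fin (c j)`, with
`(nJ j, p_{j,t}) ∈ {(3,1), (4,1), (4,2), (5,2)}` (types NORMALISED), sextic ones SIMPLE, pairwise NON-ISOGENOUS within a field.  SHAPES: `c j ≤ 2` sextic; `c j ≤ 3` octic with
`hsep` (a `(2,2)`-type contains the `τ`-member of exactly one of two `(1,3)`-types); UNFLAGGED octic: `c j ≤ 1` and the type has ONE member over `τ` (`hone`); `c j ≤ 4` decic,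
with (H1) `hmeet` and (H2) `hodd` when `c j = 4`.  ARITHMETIC: decic fields with `c j ≥ 2` with a degree-`40` pair; `Hom(KJ j', KJ j) = ∅` for `j ≠ j'` of equal degree (octic:
both flagged); a `τ`-embedding with a value outside `L(KJ j)` for `KJ j` octic → `KJ j'` sextic and for `KJ j` unflagged octic → `KJ j'` flagged octic; INTO every unflagged
octic `KJ j'` from every other `KJ j` one `τ`-embedding `s` with `[L(KJ j) ⊔ ℚ(s(KJ j')) : ℚ] = 4·[L(KJ j) : ℚ]`.  THEN the Hodge conjecture holds for `⨁_l X_l`, every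
`X_l ∈ {E} ∪ {B j t}` (any multiplicities), and for everything dominated by such a product, GIVEN ONLY Markman's two theorems.

IN WORDS (one imaginary quadratic `k`, mod Markman 4 + 6): `E_k` × up to two simple CM threefolds per sextic field × up to three simple CM fourfolds per `𝔄₄`/`𝔖₄`-octic field
(a `(2,2)`-class separating any two `(1,3)`-classes) × ONE CM fourfold of `k`-signature `(1,3)` per octic field with `C₄`/`V₄`/`D₄` quartic part × up to four `(2,3)`/`(3,2)`
fivefolds per decic field with `2`-transitive quintic part (not a four-cycle, not a triangle with a disjoint edge), all fields through `k`, non-isomorphic within each degree,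
the imprimitive octic fields linearly disjoint from the other closures, octic → sextic outside: HC for every product of copies.  By G1's rank bound and dependent patterns the
shapes are everything the units method gives; by the census the unflagged octic fields carry one class only (no `2`-transitivity).

[cite: Markman2025SurveySecant, Thm. 1.2] [cite: Markman2025SecantWeil, Thm 1.5.1] [cite: Shimura1998, §6.1 Corollary of Theorem 2, §8.2 Prop. 26, §8.4, §18.2 Lemma (i)]
[cite: Deligne1982HodgeCycles, §5 (b)] [cite: Lang2002, VI §1 Thm. 1.1, Cor. 1.6, Thm. 1.12, Thm. 1.14 and V §2 Thm. 2.8; XIII §4; XV §1] [cite: MoonenZarhin1995Duke, Thm. 2.4]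
[cite: Pohlmann1968, Thm 1] [cite: DixonMortimer1996, §1.4 Ex. 1.4.1–1.4.2; §1.6, Thm. 1.6A; §2.1; §3.3, Thm. 3.3A] [cite: Dodson1984, §1.1 Imprimitivity Theorem and §5.1.2 Theorem]
[cite: MumfordAV1970, §19]

## References
* [Markman2025SurveySecant] E. Markman, arXiv:2509.23403, Thm. 1.2.  [Markman2025SecantWeil] E. Markman, Cycles on abelian 2n-folds of Weil type from secant sheaves on abelian
  n-folds, Thm 1.5.1.  [Shimura1998] G. Shimura, *Abelian varieties with complex multiplication and modular functions*, §6.1, §8.2, §8.4, §18.2.  [Deligne1982HodgeCycles]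
  P. Deligne, LNM 900, §5 (b).  [Lang2002] S. Lang, *Algebra*, GTM 211, V §2, VI §1, XIII §4, XV §1.  [MoonenZarhin1995Duke] B. Moonen, Yu. Zarhin, Duke Math. J. 77 (1995),
  Thm. 2.4.  [Pohlmann1968] H. Pohlmann, Ann. of Math. 88 (1968), Thm 1.  [DixonMortimer1996] J. D. Dixon, B. Mortimer, *Permutation Groups*, GTM 163.  [Dodson1984] B. Dodson,
  Trans. AMS 283 (1984).  [MumfordAV1970] D. Mumford, *Abelian Varieties*, §19.
-/

noncomputable section

open CategoryTheory CategoryTheory.Limits NumberField IntermediateField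

namespace Summit.HodgeConjecture.CorCM.MultiFieldWeil

open Finset
open Literature.AlgebraicGeometry Literature.AlgebraicGeometry.Motives Literature.AlgebraicGeometry.HodgeTheory
open Literature.AlgebraicGeometry.ComplexMultiplication (IsCMTypeRealisation)
open Literature.AlgebraicTopology.SingularHomology
open Literature.NumberTheory.ComplexMultiplication

open scoped Classical

section Shapes

variable {J : Type} [Fintype J] {KJ : J → Type} [fK : ∀ j, Field (KJ j)] [nK : ∀ j, NumberField (KJ j)] [cK : ∀ j, IsCMField (KJ j)]
  {k : Type} [fk : Field k] [nk : NumberField k] [ck : IsCMField k] {τ : k →+* ℂ} {c : J → ℕ}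
  {B : ∀ j : J, Fin (c j) → AbelianVariety ℂ} {Ψ : ∀ j : J, Fin (c j) → CMType (KJ j)}
  {ιB : ∀ (j : J) (t : Fin (c j)), 𝓞 (KJ j) →+* End (B j t)} {θB : ∀ (j : J) (t : Fin (c j)), KJ j →+* Module.End ℂ (complexBetti (B j t).X 1)}
  {E : AbelianVariety ℂ} {Φ₀ : CMType k} {ιE : 𝓞 k →+* End E} {θE : k →+* Module.End ℂ (complexBetti E.X 1)}

/-- **THE NET THEOREM: THE UNITS MENU BY SHAPES WITH IMPRIMITIVE QUARTIC SINGLES — GIVEN ONLY MARKMAN'S FOURFOLD AND HYPERBOLIC-SIXFOLD THEOREMS.**  See the module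
docstring.  `HC_CM` is NOT asserted.
[cite: Markman2025SurveySecant, Thm. 1.2] [cite: Markman2025SecantWeil, Thm 1.5.1] [cite: Shimura1998, §6.1 Corollary of Theorem 2, §8.2 Prop. 26, §18.2]
[cite: Deligne1982HodgeCycles, §5 (b)] [cite: DixonMortimer1996, §1.4 Ex. 1.4.1–1.4.2; §1.6, Thm. 1.6A; §2.1] [cite: Dodson1984, §1.1 Imprimitivity Theorem and §5.1.2 Theorem]
[cite: Lang2002, XIII §4; XV §1] -/
theorem hodgeConjectureFor_biproduct_sigma_imprimitive_of_shapes (hW4 : Markman2025_weilClasses_algebraic_abelianFourfold)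
    (hM6 : Markman2025_weilClasses_algebraic_hyperbolicSixfold) (h2 : Module.finrank ℚ k = 2) (iK : ∀ j : J, k →+* KJ j) (nJ : J → ℕ)
    (hdeg : ∀ j, Module.finrank ℚ (KJ j) = 2 * nJ j) (hB : ∀ j t, IsCMTypeRealisation (Ψ j t) (B j t) (ιB j t) (θB j t))
    (hE : IsCMTypeRealisation Φ₀ E ιE θE) (hΦ₀ : ∀ σ : k →+* ℂ, σ ∈ Φ₀.1 ↔ σ = τ) (tJ : J → Prop)
    (hS : ∀ j, nJ j = 3 → ∀ t, (B j t).IsSimple)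
    (hcnt : ∀ j t, (nJ j = 3 ∧ (Finset.univ.filter fun s : KJ j →+* ℂ => s.comp (iK j) = τ ∧ s ∈ (Ψ j t).1).card = 1) ∨
      (nJ j = 4 ∧ (Finset.univ.filter fun s : KJ j →+* ℂ => s.comp (iK j) = τ ∧ s ∈ (Ψ j t).1).card = 1) ∨
      (nJ j = 4 ∧ (Finset.univ.filter fun s : KJ j →+* ℂ => s.comp (iK j) = τ ∧ s ∈ (Ψ j t).1).card = 2) ∨
      (nJ j = 5 ∧ (Finset.univ.filter fun s : KJ j →+* ℂ => s.comp (iK j) = τ ∧ s ∈ (Ψ j t).1).card = 2))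
    (hni : ∀ j t t', t ≠ t' → ¬ AbelianVariety.IsIsogenous (B j t) (B j t'))
    (hone : ∀ j, nJ j = 4 → ¬ tJ j → c j ≤ 1 ∧ ∀ t, (Finset.univ.filter fun s : KJ j →+* ℂ => s.comp (iK j) = τ ∧ s ∈ (Ψ j t).1).card = 1)
    (hc3 : ∀ j, nJ j = 3 → c j ≤ 2) (hc4 : ∀ j, nJ j = 4 → c j ≤ 3) (hc5 : ∀ j, nJ j = 5 → c j ≤ 4)
    (hsep : ∀ j, nJ j = 4 → ∀ t₁ t₂ t₃ : Fin (c j), t₁ ≠ t₂ → (Finset.univ.filter fun u : KJ j →+* ℂ => u.comp (iK j) = τ ∧ u ∈ (Ψ j t₁).1).card = 1 →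
      (Finset.univ.filter fun u : KJ j →+* ℂ => u.comp (iK j) = τ ∧ u ∈ (Ψ j t₂).1).card = 1 →
      (Finset.univ.filter fun u : KJ j →+* ℂ => u.comp (iK j) = τ ∧ u ∈ (Ψ j t₃).1).card = 2 →
      ∀ s₁ s₂ : KJ j →+* ℂ, s₁.comp (iK j) = τ → s₂.comp (iK j) = τ → s₁ ∈ (Ψ j t₁).1 → s₂ ∈ (Ψ j t₂).1 → (s₁ ∈ (Ψ j t₃).1 ↔ s₂ ∉ (Ψ j t₃).1))
    (hmeet : ∀ j, nJ j = 5 → c j = 4 → ∀ t : Fin (c j), ∃ t', t' ≠ t ∧ ∃ s : KJ j →+* ℂ, s.comp (iK j) = τ ∧ s ∈ (Ψ j t).1 ∧ s ∈ (Ψ j t').1)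
    (hodd : ∀ j, nJ j = 5 → c j = 4 → ∃ s : KJ j →+* ℂ, s.comp (iK j) = τ ∧ (Finset.univ.filter fun t : Fin (c j) => s ∈ (Ψ j t).1).card ≠ 0 ∧
      (Finset.univ.filter fun t : Fin (c j) => s ∈ (Ψ j t).1).card ≠ 2)
    (h24 : ∀ j, nJ j = 4 → tJ j → ∃ s₀ t₀ : KJ j →+* ℂ, s₀.comp (iK j) = τ ∧ t₀.comp (iK j) = τ ∧ s₀ ≠ t₀ ∧
      Module.finrank ℚ ↥(adjoin ℚ (Set.range τ) ⊔ adjoin ℚ (Set.range s₀ ∪ Set.range t₀)) = 24)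
    (h40 : ∀ j, nJ j = 5 → 1 < c j → ∃ s₀ t₀ : KJ j →+* ℂ, s₀.comp (iK j) = τ ∧ t₀.comp (iK j) = τ ∧ s₀ ≠ t₀ ∧
      Module.finrank ℚ ↥(adjoin ℚ (Set.range τ) ⊔ adjoin ℚ (Set.range s₀ ∪ Set.range t₀)) = 40)
    (hiso : ∀ j j' : J, j' ≠ j → nJ j = nJ j' → (nJ j' = 4 → tJ j' ∧ tJ j) → IsEmpty (KJ j' →+* KJ j))
    (hout4 : ∀ j j' : J, j' ≠ j → nJ j = 4 → (nJ j' = 3 ∨ (nJ j' = 4 ∧ tJ j' ∧ ¬ tJ j)) → ∃ s : KJ j' →+* ℂ, s.comp (iK j') = τ ∧ ∃ x, s x ∉ normalClosure ℚ (KJ j) ℂ)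
    (hdisj : ∀ j j' : J, j' ≠ j → nJ j' = 4 → ¬ tJ j' → ∃ s : KJ j' →+* ℂ, s.comp (iK j') = τ ∧
      Module.finrank ℚ ↥(normalClosure ℚ (KJ j) ℂ ⊔ adjoin ℚ (Set.range s)) = Module.finrank ℚ ↥(normalClosure ℚ (KJ j) ℂ) * 4)
    {N : ℕ} (κ : Fin N → Option ((j : J) × Fin (c j))) :
    HodgeConjectureFor (⨁ fun l => ((κ l).elim E fun x => B x.1 x.2 : AbelianVariety ℂ)).dim (⨁ fun l => ((κ l).elim E fun x => B x.1 x.2 : AbelianVariety ℂ)).X := by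
  -- distinct and non-conjugate types from non-isogeny (Shimura's criterion)
  have hne : ∀ j (t t' : Fin (c j)), t ≠ t' → (Ψ j t).1 ≠ (Ψ j t').1 ∧ (Ψ j t').1 ≠ (Ψ j t).1ᶜ := fun j t t' htt =>
    DihedralSexticPair.cmType_ne_and_ne_compl_of_not_isIsogenous (hB j t) (hB j t') (hni j t t' htt)
  refine hodgeConjectureFor_biproduct_sigma_imprimitive_of_linearIndependent hW4 hM6 h2 iK nJ hdeg hB hE hΦ₀ tJ hS hcnt hni hone (fun j hcj => ?_) h24 h40 hiso hout4
    hdisj κ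
  -- the independence hypothesis of U7 for a field with three or more structures, by shape
  have hcard : Fintype.card (Fin (c j)) = c j := Fintype.card_fin _
  obtain ⟨t₀⟩ : Nonempty (Fin (c j)) := ⟨⟨0, by omega⟩⟩
  rcases hcnt j t₀ with ⟨h3, -⟩ | ⟨h4, -⟩ | ⟨h4, -⟩ | ⟨h5, -⟩
  · have := hc3 j h3; omega
  · have hc : c j = 3 := by have := hc4 j h4; omega
    exact linearIndependent_typeCells_of_three_octic h2 (iK j) (hdeg j) h4 τ (by rw [hcard, hc]) (Ψ j)
      (fun t => by rcases hcnt j t with ⟨h, -⟩ | ⟨-, h⟩ | ⟨-, h⟩ | ⟨h, -⟩ <;> omega) (hne j) (hsep j h4)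
  · have hc : c j = 3 := by have := hc4 j h4; omega
    exact linearIndependent_typeCells_of_three_octic h2 (iK j) (hdeg j) h4 τ (by rw [hcard, hc]) (Ψ j)
      (fun t => by rcases hcnt j t with ⟨h, -⟩ | ⟨-, h⟩ | ⟨-, h⟩ | ⟨h, -⟩ <;> omega) (hne j) (hsep j h4)
  · have hcnt5 : ∀ t : Fin (c j), (Finset.univ.filter fun u : KJ j →+* ℂ => u.comp (iK j) = τ ∧ u ∈ (Ψ j t).1).card = 2 := fun t => by
      rcases hcnt j t with ⟨h, -⟩ | ⟨h, -⟩ | ⟨h, -⟩ | ⟨-, h⟩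
      · omega
      · omega
      · omega
      · exact h
    by_cases hc : c j = 3
    · exact linearIndependent_typeCells_of_three_pairs h2 (iK j) (hdeg j) h5 τ (by rw [hcard, hc]) (Ψ j) hcnt5 fun t t' htt => (hne j t t' htt).1
    · have hc' : c j = 4 := by have := hc5 j h5; omega
      exact linearIndependent_typeCells_of_four_pairs h2 (iK j) (hdeg j) h5 τ (by rw [hcard, hc']) (Ψ j) hcnt5 (fun t t' htt => (hne j t t' htt).1)
        (hmeet j h5 hc') (hodd j h5 hc')

/-- **Dominated form**: every complex abelian variety dominated by such a product of copies (an isogeny factor, `s ≫ π = [N]`). [cite: Markman2025SurveySecant, Thm. 1.2]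
[cite: Markman2025SecantWeil, Thm 1.5.1] [cite: MumfordAV1970, §19] -/
theorem hodgeConjectureFor_of_avDominatedBy_sigma_imprimitive_of_shapes (hW4 : Markman2025_weilClasses_algebraic_abelianFourfold)
    (hM6 : Markman2025_weilClasses_algebraic_hyperbolicSixfold) (h2 : Module.finrank ℚ k = 2) (iK : ∀ j : J, k →+* KJ j) (nJ : J → ℕ)
    (hdeg : ∀ j, Module.finrank ℚ (KJ j) = 2 * nJ j) (hB : ∀ j t, IsCMTypeRealisation (Ψ j t) (B j t) (ιB j t) (θB j t))
    (hE : IsCMTypeRealisation Φ₀ E ιE θE) (hΦ₀ : ∀ σ : k →+* ℂ, σ ∈ Φ₀.1 ↔ σ = τ) (tJ : J → Prop)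
    (hS : ∀ j, nJ j = 3 → ∀ t, (B j t).IsSimple)
    (hcnt : ∀ j t, (nJ j = 3 ∧ (Finset.univ.filter fun s : KJ j →+* ℂ => s.comp (iK j) = τ ∧ s ∈ (Ψ j t).1).card = 1) ∨
      (nJ j = 4 ∧ (Finset.univ.filter fun s : KJ j →+* ℂ => s.comp (iK j) = τ ∧ s ∈ (Ψ j t).1).card = 1) ∨
      (nJ j = 4 ∧ (Finset.univ.filter fun s : KJ j →+* ℂ => s.comp (iK j) = τ ∧ s ∈ (Ψ j t).1).card = 2) ∨
      (nJ j = 5 ∧ (Finset.univ.filter fun s : KJ j →+* ℂ => s.comp (iK j) = τ ∧ s ∈ (Ψ j t).1).card = 2))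
    (hni : ∀ j t t', t ≠ t' → ¬ AbelianVariety.IsIsogenous (B j t) (B j t'))
    (hone : ∀ j, nJ j = 4 → ¬ tJ j → c j ≤ 1 ∧ ∀ t, (Finset.univ.filter fun s : KJ j →+* ℂ => s.comp (iK j) = τ ∧ s ∈ (Ψ j t).1).card = 1)
    (hc3 : ∀ j, nJ j = 3 → c j ≤ 2) (hc4 : ∀ j, nJ j = 4 → c j ≤ 3) (hc5 : ∀ j, nJ j = 5 → c j ≤ 4)
    (hsep : ∀ j, nJ j = 4 → ∀ t₁ t₂ t₃ : Fin (c j), t₁ ≠ t₂ → (Finset.univ.filter fun u : KJ j →+* ℂ => u.comp (iK j) = τ ∧ u ∈ (Ψ j t₁).1).card = 1 →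
      (Finset.univ.filter fun u : KJ j →+* ℂ => u.comp (iK j) = τ ∧ u ∈ (Ψ j t₂).1).card = 1 →
      (Finset.univ.filter fun u : KJ j →+* ℂ => u.comp (iK j) = τ ∧ u ∈ (Ψ j t₃).1).card = 2 →
      ∀ s₁ s₂ : KJ j →+* ℂ, s₁.comp (iK j) = τ → s₂.comp (iK j) = τ → s₁ ∈ (Ψ j t₁).1 → s₂ ∈ (Ψ j t₂).1 → (s₁ ∈ (Ψ j t₃).1 ↔ s₂ ∉ (Ψ j t₃).1))
    (hmeet : ∀ j, nJ j = 5 → c j = 4 → ∀ t : Fin (c j), ∃ t', t' ≠ t ∧ ∃ s : KJ j →+* ℂ, s.comp (iK j) = τ ∧ s ∈ (Ψ j t).1 ∧ s ∈ (Ψ j t').1)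
    (hodd : ∀ j, nJ j = 5 → c j = 4 → ∃ s : KJ j →+* ℂ, s.comp (iK j) = τ ∧ (Finset.univ.filter fun t : Fin (c j) => s ∈ (Ψ j t).1).card ≠ 0 ∧
      (Finset.univ.filter fun t : Fin (c j) => s ∈ (Ψ j t).1).card ≠ 2)
    (h24 : ∀ j, nJ j = 4 → tJ j → ∃ s₀ t₀ : KJ j →+* ℂ, s₀.comp (iK j) = τ ∧ t₀.comp (iK j) = τ ∧ s₀ ≠ t₀ ∧
      Module.finrank ℚ ↥(adjoin ℚ (Set.range τ) ⊔ adjoin ℚ (Set.range s₀ ∪ Set.range t₀)) = 24)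
    (h40 : ∀ j, nJ j = 5 → 1 < c j → ∃ s₀ t₀ : KJ j →+* ℂ, s₀.comp (iK j) = τ ∧ t₀.comp (iK j) = τ ∧ s₀ ≠ t₀ ∧
      Module.finrank ℚ ↥(adjoin ℚ (Set.range τ) ⊔ adjoin ℚ (Set.range s₀ ∪ Set.range t₀)) = 40)
    (hiso : ∀ j j' : J, j' ≠ j → nJ j = nJ j' → (nJ j' = 4 → tJ j' ∧ tJ j) → IsEmpty (KJ j' →+* KJ j))
    (hout4 : ∀ j j' : J, j' ≠ j → nJ j = 4 → (nJ j' = 3 ∨ (nJ j' = 4 ∧ tJ j' ∧ ¬ tJ j)) → ∃ s : KJ j' →+* ℂ, s.comp (iK j') = τ ∧ ∃ x, s x ∉ normalClosure ℚ (KJ j) ℂ)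
    (hdisj : ∀ j j' : J, j' ≠ j → nJ j' = 4 → ¬ tJ j' → ∃ s : KJ j' →+* ℂ, s.comp (iK j') = τ ∧
      Module.finrank ℚ ↥(normalClosure ℚ (KJ j) ℂ ⊔ adjoin ℚ (Set.range s)) = Module.finrank ℚ ↥(normalClosure ℚ (KJ j) ℂ) * 4)
    {N : ℕ} (κ : Fin N → Option ((j : J) × Fin (c j))) {X : AbelianVariety ℂ}
    (hX : Domination.AVDominatedBy X (⨁ fun l => ((κ l).elim E fun x => B x.1 x.2 : AbelianVariety ℂ))) : HodgeConjectureFor X.dim X.X :=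
  Domination.hodgeConjectureFor_of_avDominatedBy
    (hodgeConjectureFor_biproduct_sigma_imprimitive_of_shapes hW4 hM6 h2 iK nJ hdeg hB hE hΦ₀ tJ hS hcnt hni hone hc3 hc4 hc5 hsep hmeet hodd h24 h40 hiso hout4 hdisj κ)
    hX

/-- **Isogeny-closed form**: every product of complex abelian varieties each ISOGENOUS to `E` or to some `B j t` (any multiplicities, any order). [cite: Markman2025SurveySecant, Thm. 1.2]
[cite: Markman2025SecantWeil, Thm 1.5.1] [cite: MumfordAV1970, §19] -/
theorem hodgeConjectureFor_biproduct_of_isIsogenous_sigma_imprimitive_of_shapes (hW4 : Markman2025_weilClasses_algebraic_abelianFourfold)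
    (hM6 : Markman2025_weilClasses_algebraic_hyperbolicSixfold) (h2 : Module.finrank ℚ k = 2) (iK : ∀ j : J, k →+* KJ j) (nJ : J → ℕ)
    (hdeg : ∀ j, Module.finrank ℚ (KJ j) = 2 * nJ j) (hB : ∀ j t, IsCMTypeRealisation (Ψ j t) (B j t) (ιB j t) (θB j t))
    (hE : IsCMTypeRealisation Φ₀ E ιE θE) (hΦ₀ : ∀ σ : k →+* ℂ, σ ∈ Φ₀.1 ↔ σ = τ) (tJ : J → Prop)
    (hS : ∀ j, nJ j = 3 → ∀ t, (B j t).IsSimple)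
    (hcnt : ∀ j t, (nJ j = 3 ∧ (Finset.univ.filter fun s : KJ j →+* ℂ => s.comp (iK j) = τ ∧ s ∈ (Ψ j t).1).card = 1) ∨
      (nJ j = 4 ∧ (Finset.univ.filter fun s : KJ j →+* ℂ => s.comp (iK j) = τ ∧ s ∈ (Ψ j t).1).card = 1) ∨
      (nJ j = 4 ∧ (Finset.univ.filter fun s : KJ j →+* ℂ => s.comp (iK j) = τ ∧ s ∈ (Ψ j t).1).card = 2) ∨
      (nJ j = 5 ∧ (Finset.univ.filter fun s : KJ j →+* ℂ => s.comp (iK j) = τ ∧ s ∈ (Ψ j t).1).card = 2))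
    (hni : ∀ j t t', t ≠ t' → ¬ AbelianVariety.IsIsogenous (B j t) (B j t'))
    (hone : ∀ j, nJ j = 4 → ¬ tJ j → c j ≤ 1 ∧ ∀ t, (Finset.univ.filter fun s : KJ j →+* ℂ => s.comp (iK j) = τ ∧ s ∈ (Ψ j t).1).card = 1)
    (hc3 : ∀ j, nJ j = 3 → c j ≤ 2) (hc4 : ∀ j, nJ j = 4 → c j ≤ 3) (hc5 : ∀ j, nJ j = 5 → c j ≤ 4)
    (hsep : ∀ j, nJ j = 4 → ∀ t₁ t₂ t₃ : Fin (c j), t₁ ≠ t₂ → (Finset.univ.filter fun u : KJ j →+* ℂ => u.comp (iK j) = τ ∧ u ∈ (Ψ j t₁).1).card = 1 →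
      (Finset.univ.filter fun u : KJ j →+* ℂ => u.comp (iK j) = τ ∧ u ∈ (Ψ j t₂).1).card = 1 →
      (Finset.univ.filter fun u : KJ j →+* ℂ => u.comp (iK j) = τ ∧ u ∈ (Ψ j t₃).1).card = 2 →
      ∀ s₁ s₂ : KJ j →+* ℂ, s₁.comp (iK j) = τ → s₂.comp (iK j) = τ → s₁ ∈ (Ψ j t₁).1 → s₂ ∈ (Ψ j t₂).1 → (s₁ ∈ (Ψ j t₃).1 ↔ s₂ ∉ (Ψ j t₃).1))
    (hmeet : ∀ j, nJ j = 5 → c j = 4 → ∀ t : Fin (c j), ∃ t', t' ≠ t ∧ ∃ s : KJ j →+* ℂ, s.comp (iK j) = τ ∧ s ∈ (Ψ j t).1 ∧ s ∈ (Ψ j t').1)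
    (hodd : ∀ j, nJ j = 5 → c j = 4 → ∃ s : KJ j →+* ℂ, s.comp (iK j) = τ ∧ (Finset.univ.filter fun t : Fin (c j) => s ∈ (Ψ j t).1).card ≠ 0 ∧
      (Finset.univ.filter fun t : Fin (c j) => s ∈ (Ψ j t).1).card ≠ 2)
    (h24 : ∀ j, nJ j = 4 → tJ j → ∃ s₀ t₀ : KJ j →+* ℂ, s₀.comp (iK j) = τ ∧ t₀.comp (iK j) = τ ∧ s₀ ≠ t₀ ∧
      Module.finrank ℚ ↥(adjoin ℚ (Set.range τ) ⊔ adjoin ℚ (Set.range s₀ ∪ Set.range t₀)) = 24)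
    (h40 : ∀ j, nJ j = 5 → 1 < c j → ∃ s₀ t₀ : KJ j →+* ℂ, s₀.comp (iK j) = τ ∧ t₀.comp (iK j) = τ ∧ s₀ ≠ t₀ ∧
      Module.finrank ℚ ↥(adjoin ℚ (Set.range τ) ⊔ adjoin ℚ (Set.range s₀ ∪ Set.range t₀)) = 40)
    (hiso : ∀ j j' : J, j' ≠ j → nJ j = nJ j' → (nJ j' = 4 → tJ j' ∧ tJ j) → IsEmpty (KJ j' →+* KJ j))
    (hout4 : ∀ j j' : J, j' ≠ j → nJ j = 4 → (nJ j' = 3 ∨ (nJ j' = 4 ∧ tJ j' ∧ ¬ tJ j)) → ∃ s : KJ j' →+* ℂ, s.comp (iK j') = τ ∧ ∃ x, s x ∉ normalClosure ℚ (KJ j) ℂ)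
    (hdisj : ∀ j j' : J, j' ≠ j → nJ j' = 4 → ¬ tJ j' → ∃ s : KJ j' →+* ℂ, s.comp (iK j') = τ ∧
      Module.finrank ℚ ↥(normalClosure ℚ (KJ j) ℂ ⊔ adjoin ℚ (Set.range s)) = Module.finrank ℚ ↥(normalClosure ℚ (KJ j) ℂ) * 4)
    {N : ℕ} (X : Fin N → AbelianVariety ℂ) (hX : ∀ l, ∃ o : Option ((j : J) × Fin (c j)), AbelianVariety.IsIsogenous (X l) (o.elim E fun x => B x.1 x.2)) :
    HodgeConjectureFor (⨁ X).dim (⨁ X).X := by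
  choose κ hκ using hX
  exact Domination.hodgeConjectureFor_of_avDominatedBy
    (hodgeConjectureFor_biproduct_sigma_imprimitive_of_shapes hW4 hM6 h2 iK nJ hdeg hB hE hΦ₀ tJ hS hcnt hni hone hc3 hc4 hc5 hsep hmeet hodd h24 h40 hiso hout4 hdisj κ)
    (Domination.AVDominatedBy.of_isIsogenous (AbelianVariety.IsIsogenous.biproduct hκ) (Domination.AVDominatedBy.refl _))

end Shapes

end Summit.HodgeConjecture.CorCM.MultiFieldWeil

end
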